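import Summits.SmoothPoincare4.SmoothPoincare4.Theorems.EntropyRungConicalGapSecondWeightedIdentity
import Literature.Geometry.Lorentzian.RicciNormSq
import HarnessLib

/-!
# Helper `helper_weightedMoments_integrable` of line `Sketch`
(crux `EntropyRung.ConicalGap`, stmt-SmoothPoincare4-16589)

Wang–Wang 2023 (arXiv:2308.06560, proof of Prop. 2.6: "the validity of `h(τ)` is ensured by the
quadratic growth of `f`"), all polynomial moments: on a complete connected normalised gradient
shrinking Ricci soliton `(M⁴, g, f)` (`Ric + Hess f = g/2`, `R + |∇f|² = f`, closed `g`-balls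
compact), for every `k : ℕ` and every `τ > 0`,

* the weights `f^k e^{-f/τ}` and `f^k R e^{-f/τ}` are `dV`-integrable
  (`weightedMoments_integrable_pow`, `weightedMoments_integrable_pow_mul_scalarCurvature`);
* GIVEN that `|Ric|² e^{-f/σ}` is integrable for every `σ > 0`, the weights `f^k |Ric|² e^{-f/τ}`
  and `f^k R |Ric|² e^{-f/τ}` are `dV`-integrable
  (`weightedMoments_integrable_pow_mul_normSq`,
  `weightedMoments_integrable_pow_mul_scalarCurvature_mul_normSq`).

The mechanism is pure domination on top of the weights of the tree
(`weightedIntegrability_riemVolume`: `e^{-f/σ}` integrable for every `σ > 0`): the elementary bound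
`t^k e^{-t/s} ≤ k! s^k` for `t ≥ 0`, `s > 0` (`weightedMoments_pow_mul_exp_le`, from
`x^k / k! ≤ e^x`, `Real.pow_div_factorial_le_exp`), the splitting
`e^{-f/τ} = e^{-f/(2τ)} · e^{-f/(2τ)}`, and `0 ≤ R ≤ f`, `0 ≤ |Ric|²` (`R + |∇f|² = f`, `|∇f|² ≥ 0`,
`R ≥ 0` and properness of `f` by
`NoncompactShrinkerGapCarrilloNiClauses.scalarCurvature_nonneg_and_isCompact_sublevel`):
`f^k e^{-f/τ} ≤ k! (2τ)^k e^{-f/(2τ)}`, `f^k R e^{-f/τ} ≤ f^{k+1} e^{-f/τ}`,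
`f^k |Ric|² e^{-f/τ} ≤ k! (2τ)^k |Ric|² e^{-f/(2τ)}`, `f^k R |Ric|² e^{-f/τ} ≤ f^{k+1} |Ric|² e^{-f/τ}`.

Everything here is proved; no definition and no named fact is introduced.

## References

* Y. Wang, G. Wang (Wang–Wang 2023), arXiv:2308.06560, Prop. 2.6.
* [CarrilloNi2009] J. Carrillo, L. Ni, Comm. Anal. Geom. 17 (2009) 721–753, §2, Cor. 2.1.
-/

noncomputable section

-- `Summit.SmoothPoincare4.SmoothPoincare4.…` (summit = problem) trips `dupNamespace` on every decl.
set_option linter.dupNamespace false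

open scoped Manifold ContDiff ENNReal NNReal Topology
open MeasureTheory Set Filter
open Literature.Geometry.Lorentzian Literature.Geometry.Riemannian

namespace Summit.SmoothPoincare4.SmoothPoincare4.Theorems.ConicalGapSketch

/-! ## The elementary bound `t^k e^{-t/s} ≤ k! s^k` on the real line -/

/-- The elementary bound `t^k e^{-t/s} ≤ k! s^k` for `t ≥ 0`, `s > 0` (from `x^k / k! ≤ e^x`,
`Real.pow_div_factorial_le_exp`, at `x = t/s`). -/
theorem weightedMoments_pow_mul_exp_le (k : ℕ) {s t : ℝ} (hs : 0 < s) (ht : 0 ≤ t) :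
    t ^ k * Real.exp (-t / s) ≤ (k.factorial : ℝ) * s ^ k := by
  have h1 := Real.pow_div_factorial_le_exp (hx := div_nonneg ht hs.le) (n := k)
  rw [div_le_iff₀ (by positivity), div_pow, div_le_iff₀ (by positivity)] at h1
  have h2 : Real.exp (t / s) * Real.exp (-t / s) = 1 := by
    rw [neg_div, ← Real.exp_add, add_neg_cancel, Real.exp_zero]
  calc t ^ k * Real.exp (-t / s)
      ≤ Real.exp (t / s) * (k.factorial : ℝ) * s ^ k * Real.exp (-t / s) :=
        mul_le_mul_of_nonneg_right h1 (Real.exp_pos _).le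
    _ = (k.factorial : ℝ) * s ^ k * (Real.exp (t / s) * Real.exp (-t / s)) := by ring
    _ = (k.factorial : ℝ) * s ^ k := by rw [h2, mul_one]

/-! ## Integrability of the polynomial-moment weights (any dimension) -/

section ProperIntegrability

variable {n : ℕ} {M : Type*} [TopologicalSpace M] [ChartedSpace (EuclideanSpace ℝ (Fin n)) M]
  [IsManifold (𝓡 n) ∞ M] [T3Space M] [MeasurableSpace M] [BorelSpace M]
  {g : PseudoRiemannianMetric (𝓡 n) ∞ (EuclideanSpace ℝ (Fin n)) (TangentSpace (𝓡 n) : M → Type _)}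
  {f : M → ℝ} [g.HasLeviCivita]

/-- The splitting `e^{-t/τ} = e^{-t/(2τ)} · e^{-t/(2τ)}` (`τ ≠ 0`). -/
theorem weightedMoments_exp_split {τ : ℝ} (hτ : τ ≠ 0) (t : ℝ) :
    Real.exp (-t / τ) = Real.exp (-t / (2 * τ)) * Real.exp (-t / (2 * τ)) := by
  rw [← Real.exp_add]
  congr 1
  field_simp
  ring

/-- **`f^k e^{-f/τ}` is integrable for every `k : ℕ`, `τ > 0`** on a gradient shrinker with proper
potential and `R ≥ 0` (Wang–Wang 2023, Prop. 2.6, quadratic growth of `f`), over `g.riemVolume`: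
`f^k e^{-f/τ} = (f^k e^{-f/(2τ)}) e^{-f/(2τ)} ≤ k! (2τ)^k e^{-f/(2τ)}`
(`weightedMoments_pow_mul_exp_le`, `f ≥ 0`), integrable by `weightedIntegrability_riemVolume` at
`2τ`. -/
theorem weightedMoments_integrable_pow (hg : g.IsRiemannian) (hf : ContMDiff (𝓡 n) 𝓘(ℝ, ℝ) ∞ f)
    (hsol : ∀ (x : M) (X Y : TangentSpace (𝓡 n) x),
      g.ricci x X Y + g.hessian f x X Y = (1 / 2 : ℝ) * g.val x X Y)
    (hnorm : ∀ x : M, g.scalarCurvature x + g.gradSq f x = f x)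
    (hprop : ∀ R : ℝ, IsCompact {x | f x ≤ R}) (hR0 : ∀ x, 0 ≤ g.scalarCurvature x) (k : ℕ)
    {τ : ℝ} (hτ : 0 < τ) :
    Integrable (fun x ↦ f x ^ k * Real.exp (-f x / τ)) g.riemVolume := by
  have hf0 : ∀ x, 0 ≤ f x := fun x ↦ by linarith [hnorm x, hR0 x, g.gradSq_nonneg hg f x]
  obtain ⟨iE2, -, -⟩ :=
    weightedIntegrability_riemVolume hg hf hsol hnorm hprop hR0 (τ := 2 * τ) (by positivity)
  have hE : Continuous fun x ↦ Real.exp (-f x / τ) :=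
    Real.continuous_exp.comp (hf.continuous.neg.div_const _)
  refine (iE2.const_mul ((k.factorial : ℝ) * (2 * τ) ^ k)).mono'
    ((hf.continuous.pow k).mul hE).aestronglyMeasurable (Eventually.of_forall fun x ↦ ?_)
  rw [Real.norm_eq_abs, abs_of_nonneg (mul_nonneg (pow_nonneg (hf0 x) k) (Real.exp_pos _).le),
    weightedMoments_exp_split hτ.ne' (f x), ← mul_assoc]
  exact mul_le_mul_of_nonneg_right (weightedMoments_pow_mul_exp_le k (by positivity) (hf0 x))
    (Real.exp_pos _).le

/-- **`f^k R e^{-f/τ}` is integrable for every `k : ℕ`, `τ > 0`** on a gradient shrinker with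
proper potential and `R ≥ 0`, over `g.riemVolume`: `0 ≤ f^k R e^{-f/τ} ≤ f^{k+1} e^{-f/τ}` since
`0 ≤ R ≤ f` (`R + |∇f|² = f`, `|∇f|² ≥ 0`), integrable by `weightedMoments_integrable_pow`. -/
theorem weightedMoments_integrable_pow_mul_scalarCurvature (hg : g.IsRiemannian)
    (hf : ContMDiff (𝓡 n) 𝓘(ℝ, ℝ) ∞ f)
    (hsol : ∀ (x : M) (X Y : TangentSpace (𝓡 n) x),
      g.ricci x X Y + g.hessian f x X Y = (1 / 2 : ℝ) * g.val x X Y)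
    (hnorm : ∀ x : M, g.scalarCurvature x + g.gradSq f x = f x)
    (hprop : ∀ R : ℝ, IsCompact {x | f x ≤ R}) (hR0 : ∀ x, 0 ≤ g.scalarCurvature x) (k : ℕ)
    {τ : ℝ} (hτ : 0 < τ) :
    Integrable (fun x ↦ f x ^ k * g.scalarCurvature x * Real.exp (-f x / τ)) g.riemVolume := by
  have hf0 : ∀ x, 0 ≤ f x := fun x ↦ by linarith [hnorm x, hR0 x, g.gradSq_nonneg hg f x]
  have hRle : ∀ x, g.scalarCurvature x ≤ f x := fun x ↦ by
    linarith [hnorm x, g.gradSq_nonneg hg f x]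
  have hE : Continuous fun x ↦ Real.exp (-f x / τ) :=
    Real.continuous_exp.comp (hf.continuous.neg.div_const _)
  have hSc : Continuous fun x ↦ g.scalarCurvature x :=
    (PseudoRiemannianMetric.contMDiff_scalarCurvature g).continuous
  refine (weightedMoments_integrable_pow hg hf hsol hnorm hprop hR0 (k + 1) hτ).mono
    (((hf.continuous.pow k).mul hSc).mul hE).aestronglyMeasurable
    (Eventually.of_forall fun x ↦ ?_)
  rw [Real.norm_eq_abs, Real.norm_eq_abs,
    abs_of_nonneg (mul_nonneg (mul_nonneg (pow_nonneg (hf0 x) k) (hR0 x)) (Real.exp_pos _).le),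
    abs_of_nonneg (mul_nonneg (pow_nonneg (hf0 x) _) (Real.exp_pos _).le), pow_succ]
  exact mul_le_mul_of_nonneg_right (mul_le_mul_of_nonneg_left (hRle x) (pow_nonneg (hf0 x) k))
    (Real.exp_pos _).le

/-- **`f^k |Ric|² e^{-f/τ}` is integrable for every `k : ℕ`, `τ > 0`, GIVEN that `|Ric|² e^{-f/σ}`
is integrable for every `σ > 0`**, on a normalised gradient shrinker with `R ≥ 0` (so `f ≥ 0`),
over `g.riemVolume`: `f^k |Ric|² e^{-f/τ} = (f^k e^{-f/(2τ)}) |Ric|² e^{-f/(2τ)}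
≤ k! (2τ)^k |Ric|² e^{-f/(2τ)}` (`weightedMoments_pow_mul_exp_le`, `|Ric|² ≥ 0` by
`normSq_nonneg`), the hypothesis at `σ = 2τ`. -/
theorem weightedMoments_integrable_pow_mul_normSq (hg : g.IsRiemannian)
    (hf : ContMDiff (𝓡 n) 𝓘(ℝ, ℝ) ∞ f)
    (hnorm : ∀ x : M, g.scalarCurvature x + g.gradSq f x = f x)
    (hR0 : ∀ x, 0 ≤ g.scalarCurvature x)
    (hRic : ∀ σ : ℝ, 0 < σ →
      Integrable (fun x ↦ g.normSq x (g.ricci x) * Real.exp (-f x / σ)) g.riemVolume)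
    (k : ℕ) {τ : ℝ} (hτ : 0 < τ) :
    Integrable (fun x ↦ f x ^ k * g.normSq x (g.ricci x) * Real.exp (-f x / τ)) g.riemVolume := by
  have hf0 : ∀ x, 0 ≤ f x := fun x ↦ by linarith [hnorm x, hR0 x, g.gradSq_nonneg hg f x]
  have hQ0 : ∀ x, 0 ≤ g.normSq x (g.ricci x) := fun x ↦ g.normSq_nonneg x hg _
  have hE : Continuous fun x ↦ Real.exp (-f x / τ) :=
    Real.continuous_exp.comp (hf.continuous.neg.div_const _)
  have hQc : Continuous fun x ↦ g.normSq x (g.ricci x) := g.contMDiff_normSq_ricci'.continuous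
  refine ((hRic (2 * τ) (by positivity)).const_mul ((k.factorial : ℝ) * (2 * τ) ^ k)).mono'
    (((hf.continuous.pow k).mul hQc).mul hE).aestronglyMeasurable
    (Eventually.of_forall fun x ↦ ?_)
  rw [Real.norm_eq_abs,
    abs_of_nonneg (mul_nonneg (mul_nonneg (pow_nonneg (hf0 x) k) (hQ0 x)) (Real.exp_pos _).le),
    weightedMoments_exp_split hτ.ne' (f x)]
  calc f x ^ k * g.normSq x (g.ricci x) * (Real.exp (-f x / (2 * τ)) * Real.exp (-f x / (2 * τ)))
      = (f x ^ k * Real.exp (-f x / (2 * τ))) *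
          (g.normSq x (g.ricci x) * Real.exp (-f x / (2 * τ))) := by ring
    _ ≤ (k.factorial : ℝ) * (2 * τ) ^ k * (g.normSq x (g.ricci x) * Real.exp (-f x / (2 * τ))) :=
        mul_le_mul_of_nonneg_right (weightedMoments_pow_mul_exp_le k (by positivity) (hf0 x))
          (mul_nonneg (hQ0 x) (Real.exp_pos _).le)

/-- **`f^k R |Ric|² e^{-f/τ}` is integrable for every `k : ℕ`, `τ > 0`, GIVEN that `|Ric|² e^{-f/σ}`
is integrable for every `σ > 0`**, on a normalised gradient shrinker with `R ≥ 0`, over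
`g.riemVolume`: `0 ≤ f^k R |Ric|² e^{-f/τ} ≤ f^{k+1} |Ric|² e^{-f/τ}` since `0 ≤ R ≤ f` and
`|Ric|² ≥ 0`, integrable by `weightedMoments_integrable_pow_mul_normSq`. -/
theorem weightedMoments_integrable_pow_mul_scalarCurvature_mul_normSq (hg : g.IsRiemannian)
    (hf : ContMDiff (𝓡 n) 𝓘(ℝ, ℝ) ∞ f)
    (hnorm : ∀ x : M, g.scalarCurvature x + g.gradSq f x = f x)
    (hR0 : ∀ x, 0 ≤ g.scalarCurvature x)
    (hRic : ∀ σ : ℝ, 0 < σ →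
      Integrable (fun x ↦ g.normSq x (g.ricci x) * Real.exp (-f x / σ)) g.riemVolume)
    (k : ℕ) {τ : ℝ} (hτ : 0 < τ) :
    Integrable (fun x ↦ f x ^ k * g.scalarCurvature x * g.normSq x (g.ricci x) *
      Real.exp (-f x / τ)) g.riemVolume := by
  have hf0 : ∀ x, 0 ≤ f x := fun x ↦ by linarith [hnorm x, hR0 x, g.gradSq_nonneg hg f x]
  have hRle : ∀ x, g.scalarCurvature x ≤ f x := fun x ↦ by
    linarith [hnorm x, g.gradSq_nonneg hg f x]
  have hQ0 : ∀ x, 0 ≤ g.normSq x (g.ricci x) := fun x ↦ g.normSq_nonneg x hg _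
  have hE : Continuous fun x ↦ Real.exp (-f x / τ) :=
    Real.continuous_exp.comp (hf.continuous.neg.div_const _)
  have hSc : Continuous fun x ↦ g.scalarCurvature x :=
    (PseudoRiemannianMetric.contMDiff_scalarCurvature g).continuous
  have hQc : Continuous fun x ↦ g.normSq x (g.ricci x) := g.contMDiff_normSq_ricci'.continuous
  refine (weightedMoments_integrable_pow_mul_normSq hg hf hnorm hR0 hRic (k + 1) hτ).mono
    ((((hf.continuous.pow k).mul hSc).mul hQc).mul hE).aestronglyMeasurable
    (Eventually.of_forall fun x ↦ ?_)
  rw [Real.norm_eq_abs, Real.norm_eq_abs,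
    abs_of_nonneg (mul_nonneg (mul_nonneg (mul_nonneg (pow_nonneg (hf0 x) k) (hR0 x)) (hQ0 x))
      (Real.exp_pos _).le),
    abs_of_nonneg (mul_nonneg (mul_nonneg (pow_nonneg (hf0 x) _) (hQ0 x)) (Real.exp_pos _).le),
    pow_succ]
  exact mul_le_mul_of_nonneg_right (mul_le_mul_of_nonneg_right
    (mul_le_mul_of_nonneg_left (hRle x) (pow_nonneg (hf0 x) k)) (hQ0 x)) (Real.exp_pos _).le

end ProperIntegrability

/-! ## The registered helper -/

/-- **Helper `helper_weightedMoments_integrable` of line `Sketch`** (Wang–Wang 2023,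
arXiv:2308.06560, proof of Prop. 2.6, `n = 4`, all polynomial moments): on every complete connected
normalised 4-d gradient shrinking Ricci soliton, (i) for every `k : ℕ` and `τ > 0` the weights
`f^k e^{-f/τ}` and `f^k R e^{-f/τ}` are integrable, and (ii) IF `|Ric|² e^{-f/σ}` is integrable for
every `σ > 0` THEN for every `k : ℕ` and `τ > 0` the weights `f^k |Ric|² e^{-f/τ}` and
`f^k R |Ric|² e^{-f/τ}` are integrable (`dV` the Riemannian measure of
`g.toContMDiffRiemannianMetric hg`, to which `g.riemVolume` unfolds by `riemVolume_eq`): `R ≥ 0` and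
properness of `f` (`NoncompactShrinkerGapCarrilloNiClauses.scalarCurvature_nonneg_and_isCompact_sublevel`),
then `weightedMoments_integrable_pow`, `weightedMoments_integrable_pow_mul_scalarCurvature`,
`weightedMoments_integrable_pow_mul_normSq`,
`weightedMoments_integrable_pow_mul_scalarCurvature_mul_normSq`. -/
theorem helper_weightedMoments_integrable : ∀ (M : Type) [TopologicalSpace M] [T2Space M] [SecondCountableTopology M] [ChartedSpace (EuclideanSpace ℝ (Fin 4)) M] [IsManifold (𝓡 4) ∞ M] [ConnectedSpace M] [T3Space M] [MeasurableSpace M] [BorelSpace M] (g : Literature.Geometry.Lorentzian.PseudoRiemannianMetric (𝓡 4) ∞ (EuclideanSpace ℝ (Fin 4)) (TangentSpace (𝓡 4) : M → Type _)) [g.HasLeviCivita] (f : M → ℝ) (hg : g.IsRiemannian), (∀ (x : M) (r : NNReal), IsCompact {y : M | g.edist hg x y ≤ r}) → ContMDiff (𝓡 4) 𝓘(ℝ, ℝ) ∞ f → (∀ (x : M) (X Y : TangentSpace (𝓡 4) x), g.ricci x X Y + g.hessian f x X Y = (1 / 2 : ℝ) * g.val x X Y) → (∀ x : M, g.scalarCurvature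 x + g.gradSq f x = f x) → (∀ (k : ℕ) (τ : ℝ), 0 < τ → MeasureTheory.Integrable (fun x ↦ f x ^ k * Real.exp (-f x / τ)) (Literature.Geometry.Lorentzian.riemannianMeasure (g.toContMDiffRiemannianMetric hg)) ∧ MeasureTheory.Integrable (fun x ↦ f x ^ k * g.scalarCurvature x * Real.exp (-f x / τ)) (Literature.Geometry.Lorentzian.riemannianMeasure (g.toContMDiffRiemannianMetric hg))) ∧ ((∀ σ : ℝ, 0 < σ → MeasureTheory.Integrable (fun x ↦ g.normSq x (g.ricci x) * Real.exp (-f x / σ)) (Literature.Geometry.Lorentzian.riemannianMeasure (g.toContMDiffRiemannianMetric hg))) → ∀ (k : ℕ) (τ : ℝ), 0 < τ → MeasureTheory.Integrable (fun x ↦ f x ^ k * g.normSq x (g.ricci x) * Real.exp (-f x / τ)) (Literature.Geometry.Lorentzian.riemannianMeasure (g.toContMDiffRiemannianMetric hg)) ∧ MeasureTheory.Integrable (fun x ↦ f x ^ k * g.scalarCurvature x * g.normSq x (g.ricci x) * Real.exp (-f x / τ)) (Literature.Geometry.Lorentzian.riemannianMeasure (g.toContMDiffRiemannianMetric hg)))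 := by
  intro M _ _ _ _ _ _ _ _ _ g _ f hg hc hf hsol hnorm
  obtain ⟨hR0, -, hprop⟩ :=
    NoncompactShrinkerGapCarrilloNiClauses.scalarCurvature_nonneg_and_isCompact_sublevel g f hg hc hf
      hsol hnorm
  rw [← PseudoRiemannianMetric.riemVolume_eq hg]
  exact ⟨fun k τ hτ ↦ ⟨weightedMoments_integrable_pow hg hf hsol hnorm hprop hR0 k hτ,
      weightedMoments_integrable_pow_mul_scalarCurvature hg hf hsol hnorm hprop hR0 k hτ⟩,
    fun hRic k τ hτ ↦ ⟨weightedMoments_integrable_pow_mul_normSq hg hf hnorm hR0 hRic k hτ,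
      weightedMoments_integrable_pow_mul_scalarCurvature_mul_normSq hg hf hnorm hR0 hRic k hτ⟩⟩

end Summit.SmoothPoincare4.SmoothPoincare4.Theorems.ConicalGapSketch

end
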